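import Literature.Probability.LatticeModels.EdgeKilledAnnulusManeuver
import Literature.Probability.LatticeModels.KilledWalkHubFactorisation
import HarnessLib

/-!
# Hitting a box across a clean annulus: the Harnack-chain step for hitting probabilities

Topic `Literature/Probability/LatticeModels` (continuation of `EdgeKilledAnnulusManeuver.lean`,
`AnnulusManeuver.lean`, `KilledWalkHubFactorisation.lean`). For the edge-killed walk `Gr ≤ ℤ²`
in a finite region `Λ` and a target set `B ⊆ Λ`: if the frame `[c-48k,c+48k]²` (`mW c k`) lies in
`Λ` with all lattice edges at its sites kept, and `B` contains a vertical lattice segment spanning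
the top strip `c₁ + 12k ≤ x₁ ≤ c₁ + 36k` of the frame at an abscissa `α` with `|α - c₀| < 36k`,
then from every site of the box of radius `12k` about `c` the walk hits `B` before leaving `Λ`
with probability at least the universal `maneuverConst` (`maneuverConst_le_hitProb`). This is the
step of a Harnack chain for hitting probabilities (Chelkak 2016, proof of Proposition 3.3:
`P[hit the next ball of the chain] ≥ const`), for the square lattice.

Proof. Let `Gr_B` be `Gr` with the edges touching `B` removed (`avoidGraph`). (1) On the frame,
`1 - edgeSurvive Gr_B (mW c k) ≤ hitProb Gr Λ B` (`one_sub_edgeSurvive_le_hitProb`): the sum of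
the two probabilities is harmonic for the *free* walk on the frame minus `B` (all edges at frame
sites are kept; the survival probability of `Gr_B` vanishes on `B`) and is `≥ 1` outside, so the
minimum principle applies. (2) `edgeSurvive Gr_B (mW c k) ≤ 1 - maneuverConst` on the start box
(`edgeSurvive_avoidGraph_le`): by `chainM_sub_chainNE_le` and `maneuverConst_le_chainM` it
suffices that the kept chain `chainNE Gr_B` vanishes, and a positive value would give a kept
left–right crossing of the top strip (`exists_keptCrossings_of_chainNE_pos`), which passes the
abscissa `α` inside the strip (a discrete intermediate value theorem, `exists_adj_apply_eq`) at a
vertex of `B` carrying a `Gr_B`-edge — impossible.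

Everything is proved. [cite: Chelkak2016, §3.2 (proof of Prop. 3.3); Smirnov2010, Lemma B.2]
-/

noncomputable section

open scoped Classical

namespace Literature.Probability.LatticeModels

open Finset SimpleGraph

variable {Gr : SimpleGraph (Site 2)}

/-! ### The graph with the edges touching `B` removed -/

/-- `avoidGraph Gr B`: the subgraph of `Gr` of edges with no endpoint in `B` (the walk along it is
killed when it would touch `B`). [folklore] -/
def avoidGraph (Gr : SimpleGraph (Site 2)) (B : Set (Site 2)) : SimpleGraph (Site 2) :=
  Gr ⊓ SimpleGraph.fromRel fun a b => a ∉ B ∧ b ∉ B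

/-- Adjacency in `avoidGraph Gr B`. [folklore] -/
theorem avoidGraph_adj {Gr : SimpleGraph (Site 2)} {B : Set (Site 2)} {a b : Site 2} :
    (avoidGraph Gr B).Adj a b ↔ Gr.Adj a b ∧ a ∉ B ∧ b ∉ B := by
  simp only [avoidGraph, SimpleGraph.inf_adj, SimpleGraph.fromRel_adj, ne_eq]
  constructor
  · rintro ⟨h, -, h' | h'⟩
    · exact ⟨h, h'⟩
    · exact ⟨h, h'.2, h'.1⟩
  · rintro ⟨h, ha, hb⟩
    exact ⟨h, h.ne, Or.inl ⟨ha, hb⟩⟩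

/-- `avoidGraph Gr B ≤ Gr`. [folklore] -/
theorem avoidGraph_le (Gr : SimpleGraph (Site 2)) (B : Set (Site 2)) : avoidGraph Gr B ≤ Gr :=
  fun _ _ h => (avoidGraph_adj.1 h).1

/-- On `B` (inside `W`) the survival probability of `avoidGraph Gr B` vanishes: a site of `B` has
no edges. [folklore] -/
theorem edgeSurvive_avoidGraph_of_mem {B W : Set (Site 2)} (hW : W.Finite) {b : Site 2} (hb : b ∈ B) (hbW : b ∈ W) :
    edgeSurvive (avoidGraph Gr B) W b = 0 := by
  have h := killedHarmExt_harmonicOn (Gr := avoidGraph Gr B) hW (fun _ => (1 : ℝ)) b hbW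
  unfold edgeSurvive
  rw [h, killedAvg, Finset.sum_eq_zero fun e _ => ?_, mul_zero]
  rw [if_neg]
  exact fun hadj => (avoidGraph_adj.1 hadj).2.1 hb

/-! ### Survival of the `B`-avoiding walk bounds the hitting probability -/

/-- **`1 - edgeSurvive (avoidGraph Gr B) W ≤ hitProb Gr Λ B` on `W`**, when `B ⊆ W ⊆ Λ` and all
four lattice edges are `Gr`-edges at every site of `W`: dying (for the `B`-avoiding walk) before
leaving `W` means touching `B`. [folklore] -/
theorem one_sub_edgeSurvive_le_hitProb {Λ B W : Set (Site 2)} (hΛ : Λ.Finite) (hBW : B ⊆ W) (hWΛ : W ⊆ Λ)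
    (hclean : ∀ v ∈ W, ∀ e : SRW.Dir 2, Gr.Adj v (v + SRW.stepVec e)) :
    ∀ x ∈ W, 1 - edgeSurvive (avoidGraph Gr B) W x ≤ hitProb Gr Λ B x := by
  have hW : W.Finite := hΛ.subset hWΛ
  set s := edgeSurvive (avoidGraph Gr B) W with hs
  set f := hitProb Gr Λ B with hf
  -- the three mean-value identities on `W ∖ B`, all with the full lattice average
  have hs_avg : ∀ v ∈ W \ B, s v = 4⁻¹ * ∑ e : SRW.Dir 2, s (v + SRW.stepVec e) := by
    intro v hv
    have h := killedHarmExt_harmonicOn (Gr := avoidGraph Gr B) hW (fun _ => (1 : ℝ)) v hv.1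
    change s v = killedAvg (avoidGraph Gr B) s v at h
    rw [h, killedAvg]
    congr 1
    refine Finset.sum_congr rfl fun e _ => ?_
    by_cases hB : v + SRW.stepVec e ∈ B
    · rw [if_neg (fun hadj : (avoidGraph Gr B).Adj v _ => (avoidGraph_adj.1 hadj).2.2 hB)]
      by_cases hWe : v + SRW.stepVec e ∈ W
      · rw [hs, edgeSurvive_avoidGraph_of_mem hW hB hWe]
      · exact absurd (hBW hB) hWe
    · rw [if_pos (avoidGraph_adj.2 ⟨hclean v hv.1 e, hv.2, hB⟩)]
  have hf_avg : ∀ v ∈ W \ B, f v = 4⁻¹ * ∑ e : SRW.Dir 2, f (v + SRW.stepVec e) := by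
    intro v hv
    have h := hitProb_harmonicOn (Gr := Gr) (B := B) hΛ v ⟨hWΛ hv.1, hv.2⟩
    change f v = killedAvg Gr f v at h
    rw [h, killedAvg]
    congr 1
    exact Finset.sum_congr rfl fun e _ => if_pos (hclean v hv.1 e)
  -- `φ = 1 - s - f` is harmonic for the free walk on `W ∖ B`
  set φ : Site 2 → ℝ := fun z => 1 - s z - f z with hφ
  have hsub : IsKilledSubharmonicOn (zdGraph 2) φ (W \ B) := by
    intro v hv
    rw [killedAvg_eq_of_forall_adj (zdGraph 2) (fun e => zdGraph_adj_add_stepVec v e),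
      ← sum_dir_eq_sum_cornerUnit (fun w => φ (v + w))]
    simp only [hφ, Finset.sum_sub_distrib, Finset.sum_const, Finset.card_univ, SRW.card_dir, nsmul_eq_mul]
    rw [hs_avg v hv, hf_avg v hv]
    push_cast
    linarith
  -- boundary values `≤ 0`
  have hbd : ∀ w ∈ killedOuterBoundary (zdGraph 2) (W \ B), φ w ≤ 0 := by
    intro w hw
    have hwS : w ∉ W \ B := hw.1
    simp only [hφ]
    by_cases hwW : w ∈ W
    · have hwB : w ∈ B := by by_contra h; exact hwS ⟨hwW, h⟩
      rw [hf, hitProb_of_mem hwB, hs, edgeSurvive_avoidGraph_of_mem hW hwB hwW]; norm_num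
    · rw [hs, edgeSurvive_of_not_mem hwW]
      have := hitProb_nonneg (Gr := Gr) (B := B) hΛ w
      rw [← hf] at this; linarith
  have hle := hsub.le_of_forall_boundary_le (hW.subset fun _ hz => hz.1) le_rfl hbd
  intro x hx
  by_cases hxB : x ∈ B
  · rw [hf, hs, hitProb_of_mem hxB, edgeSurvive_avoidGraph_of_mem hW hxB hx]; norm_num
  · have := hle x ⟨hx, hxB⟩
    simp only [hφ] at this
    linarith

/-! ### A discrete intermediate value theorem along lattice walks -/

/-- Coordinates change by at most one along an edge of `ℤ²`. [folklore] -/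
theorem apply_sub_apply_le_one_of_adj {a b : Site 2} (h : (zdGraph 2).Adj a b) (j : Fin 2) :
    b j - a j ≤ 1 ∧ a j - b j ≤ 1 := by
  rw [zdGraph_adj_iff] at h
  obtain ⟨i, h | h⟩ := h
  · rw [h]; by_cases hij : j = i
    · subst hij; simp
    · simp [hij]
  · rw [h]; by_cases hij : j = i
    · subst hij; simp
    · simp [hij]

/-- **Discrete intermediate value theorem.** A walk in a subgraph of `ℤ²` whose support contains a
vertex with `z₀ < α` and a vertex with `α ≤ z₀` contains a vertex `z` with `z₀ = α` carrying an
edge of the walk's graph. [folklore] -/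
theorem exists_adj_apply_eq {G : SimpleGraph (Site 2)} (hG : G ≤ zdGraph 2) (j : Fin 2) (α : ℤ) :
    ∀ {u v : Site 2} (p : G.Walk u v), (∃ z₁ ∈ p.support, z₁ j < α) → (∃ z₂ ∈ p.support, α ≤ z₂ j) →
      ∃ z z' : Site 2, z ∈ p.support ∧ G.Adj z z' ∧ z j = α := by
  intro u v p
  induction p with
  | nil =>
    rintro ⟨z₁, hz₁, h₁⟩ ⟨z₂, hz₂, h₂⟩
    simp only [Walk.support_nil, List.mem_singleton] at hz₁ hz₂
    subst hz₁; subst hz₂; omega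
  | @cons a b w hadj p ih =>
    rintro ⟨z₁, hz₁, h₁⟩ ⟨z₂, hz₂, h₂⟩
    rw [Walk.support_cons, List.mem_cons] at hz₁ hz₂
    have hab := apply_sub_apply_le_one_of_adj (hG hadj) j
    have hb_mem : b ∈ p.support := p.start_mem_support
    -- helper: conclude from a hit inside `p`
    have lift : (∃ z z' : Site 2, z ∈ p.support ∧ G.Adj z z' ∧ z j = α) →
        ∃ z z' : Site 2, z ∈ (Walk.cons hadj p).support ∧ G.Adj z z' ∧ z j = α := by
      rintro ⟨z, z', hz, hzz', hzα⟩
      exact ⟨z, z', by rw [Walk.support_cons]; exact List.mem_cons_of_mem _ hz, hzz', hzα⟩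
    rcases hz₁ with rfl | hz₁ <;> rcases hz₂ with rfl | hz₂
    · omega
    · -- `z₁ = a` with `a j < α`, `z₂ ∈ p.support`
      by_cases hbα : b j = α
      · exact ⟨b, z₁, by rw [Walk.support_cons]; exact List.mem_cons_of_mem _ hb_mem, hadj.symm, hbα⟩
      · exact lift (ih ⟨b, hb_mem, by omega⟩ ⟨z₂, hz₂, h₂⟩)
    · -- `z₂ = a` with `α ≤ a j`, `z₁ ∈ p.support`
      by_cases haα : z₂ j = α
      · exact ⟨z₂, b, by rw [Walk.support_cons]; exact List.mem_cons_self, hadj, haα⟩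
      · exact lift (ih ⟨z₁, hz₁, h₁⟩ ⟨b, hb_mem, by omega⟩)
    · exact lift (ih ⟨z₁, hz₁, h₁⟩ ⟨z₂, hz₂, h₂⟩)

/-! ### The `B`-avoiding walk cannot perform the maneuver -/

/-- **Survival bound for the `B`-avoiding walk.** If `Gr ≤ ℤ²` and `B` contains the vertical
lattice segment `{α} × [c₁ + 12k, c₁ + 36k]` with `|α - c₀| < 36k`, then on the box of radius
`12k` about `c` the `B`-avoiding walk leaves the frame of radius `48k` alive with probability at
most `1 - maneuverConst`. [cite: Smirnov2010, Lemma B.2; Chelkak2016, §3.2] -/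
theorem edgeSurvive_avoidGraph_le (hGr : Gr ≤ zdGraph 2) {B : Set (Site 2)} {c : Site 2} {k : ℕ} (hk : 0 < k)
    {α : ℤ} (hα₁ : c 0 - 36 * k < α) (hα₂ : α < c 0 + 36 * k)
    (hseg : ∀ z : Site 2, z 0 = α → c 1 + 12 * k ≤ z 1 → z 1 ≤ c 1 + 36 * k → z ∈ B)
    {x : Site 2} (hx : x ∈ mB c k) :
    edgeSurvive (avoidGraph Gr B) (mW c k) x ≤ 1 - maneuverConst := by
  set Gr' := avoidGraph Gr B
  have hIII := chainM_sub_chainNE_le (Gr := Gr') (U := mU c k) (L := mL c k) (n := 12) (mU_finite c k)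
    (mW_finite c k) mU_subset_mW 12 x
  have hII := maneuverConst_le_chainM hk hx (c := c)
  have hI : chainNE Gr' (mU c k) (mL c k) 12 12 x = 0 := by
    by_contra hne
    have hpos : 0 < chainNE Gr' (mU c k) (mL c k) 12 12 x :=
      lt_of_le_of_ne (chainNE_mem_Icc (mU_finite c k) 12 x).1 (Ne.symm hne)
    obtain ⟨⟨u, v, σ, ⟨zL, hzL, hzL0⟩, ⟨zR, hzR, hzR0⟩, hband⟩, -, -, -⟩ := exists_keptCrossings_of_chainNE_pos hk hx hpos
    have hG' : Gr' ≤ zdGraph 2 := (avoidGraph_le Gr B).trans hGr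
    obtain ⟨z, z', hz, hzz', hzα⟩ :=
      exists_adj_apply_eq hG' 0 α σ ⟨zL, hzL, by omega⟩ ⟨zR, hzR, by omega⟩
    have hzB : z ∈ B := hseg z hzα (hband z hz).1 (hband z hz).2
    exact (avoidGraph_adj.1 hzz').2.1 hzB
  rw [hI, sub_zero] at hIII
  linarith

/-! ### The hitting estimate -/

/-- **Hitting a set across a clean frame.** Let `Gr ≤ ℤ²`, `Λ` finite, `B ⊆ mW c k ⊆ Λ` with all
four lattice edges kept at every site of the frame `mW c k`, and suppose `B` contains the vertical
segment `{α} × [c₁ + 12k, c₁ + 36k]` for some `|α - c₀| < 36k`. Then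
`maneuverConst ≤ hitProb Gr Λ B x` for every `x` in the box of radius `12k` about `c`.
[cite: Chelkak2016, §3.2 (Harnack chain step in the proof of Prop. 3.3)] -/
theorem maneuverConst_le_hitProb (hGr : Gr ≤ zdGraph 2) {Λ B : Set (Site 2)} (hΛ : Λ.Finite) {c : Site 2} {k : ℕ}
    (hk : 0 < k) (hBW : B ⊆ mW c k) (hWΛ : mW c k ⊆ Λ)
    (hclean : ∀ v ∈ mW c k, ∀ e : SRW.Dir 2, Gr.Adj v (v + SRW.stepVec e))
    {α : ℤ} (hα₁ : c 0 - 36 * k < α) (hα₂ : α < c 0 + 36 * k)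
    (hseg : ∀ z : Site 2, z 0 = α → c 1 + 12 * k ≤ z 1 → z 1 ≤ c 1 + 36 * k → z ∈ B)
    {x : Site 2} (hx : x ∈ mB c k) : maneuverConst ≤ hitProb Gr Λ B x := by
  have h1 := one_sub_edgeSurvive_le_hitProb hΛ hBW hWΛ hclean x (mB_subset_mW hx)
  have h2 := edgeSurvive_avoidGraph_le hGr hk hα₁ hα₂ hseg hx
  linarith

/-! ### All four strips, and chains of boxes -/

/-- **Survival bound, any of the four frame strips blocked.** As `edgeSurvive_avoidGraph_le`, with
the blocking lattice segment of `B` spanning the top, the right, the bottom or the left strip of the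
frame. [cite: Smirnov2010, Lemma B.2; Chelkak2016, §3.2] -/
theorem edgeSurvive_avoidGraph_le_of_strip (hGr : Gr ≤ zdGraph 2) {B : Set (Site 2)} {c : Site 2} {k : ℕ} (hk : 0 < k)
    (hseg : (∃ α : ℤ, c 0 - 36 * k < α ∧ α < c 0 + 36 * k ∧
        ∀ z : Site 2, z 0 = α → c 1 + 12 * k ≤ z 1 → z 1 ≤ c 1 + 36 * k → z ∈ B) ∨
      (∃ β : ℤ, c 1 - 36 * k < β ∧ β < c 1 + 36 * k ∧
        ∀ z : Site 2, z 1 = β → c 0 + 12 * k ≤ z 0 → z 0 ≤ c 0 + 36 * k → z ∈ B) ∨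
      (∃ α : ℤ, c 0 - 36 * k < α ∧ α < c 0 + 36 * k ∧
        ∀ z : Site 2, z 0 = α → c 1 - 36 * k ≤ z 1 → z 1 ≤ c 1 - 12 * k → z ∈ B) ∨
      (∃ β : ℤ, c 1 - 36 * k < β ∧ β < c 1 + 36 * k ∧
        ∀ z : Site 2, z 1 = β → c 0 - 36 * k ≤ z 0 → z 0 ≤ c 0 - 12 * k → z ∈ B))
    {x : Site 2} (hx : x ∈ mB c k) :
    edgeSurvive (avoidGraph Gr B) (mW c k) x ≤ 1 - maneuverConst := by
  set Gr' := avoidGraph Gr B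
  have hIII := chainM_sub_chainNE_le (Gr := Gr') (U := mU c k) (L := mL c k) (n := 12) (mU_finite c k)
    (mW_finite c k) mU_subset_mW 12 x
  have hII := maneuverConst_le_chainM hk hx (c := c)
  have hG' : Gr' ≤ zdGraph 2 := (avoidGraph_le Gr B).trans hGr
  have hI : chainNE Gr' (mU c k) (mL c k) 12 12 x = 0 := by
    by_contra hne
    have hpos : 0 < chainNE Gr' (mU c k) (mL c k) 12 12 x :=
      lt_of_le_of_ne (chainNE_mem_Icc (mU_finite c k) 12 x).1 (Ne.symm hne)
    obtain ⟨⟨u₁, v₁, σ₁, ⟨zL₁, hzL₁, hzL₁0⟩, ⟨zR₁, hzR₁, hzR₁0⟩, hband₁⟩, ⟨u₂, v₂, σ₂, ⟨zL₂, hzL₂, hzL₂0⟩, ⟨zR₂, hzR₂, hzR₂0⟩, hband₂⟩,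
      ⟨u₃, v₃, σ₃, ⟨zL₃, hzL₃, hzL₃0⟩, ⟨zR₃, hzR₃, hzR₃0⟩, hband₃⟩, ⟨u₄, v₄, σ₄, ⟨zL₄, hzL₄, hzL₄0⟩, ⟨zR₄, hzR₄, hzR₄0⟩, hband₄⟩⟩ :=
      exists_keptCrossings_of_chainNE_pos hk hx hpos
    rcases hseg with ⟨α, hα₁, hα₂, hseg⟩ | ⟨β, hβ₁, hβ₂, hseg⟩ | ⟨α, hα₁, hα₂, hseg⟩ | ⟨β, hβ₁, hβ₂, hseg⟩
    · obtain ⟨z, z', hz, hzz', hzα⟩ := exists_adj_apply_eq hG' 0 α σ₁ ⟨zL₁, hzL₁, by omega⟩ ⟨zR₁, hzR₁, by omega⟩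
      exact (avoidGraph_adj.1 hzz').2.1 (hseg z hzα (hband₁ z hz).1 (hband₁ z hz).2)
    · obtain ⟨z, z', hz, hzz', hzβ⟩ := exists_adj_apply_eq hG' 1 β σ₂ ⟨zL₂, hzL₂, by omega⟩ ⟨zR₂, hzR₂, by omega⟩
      exact (avoidGraph_adj.1 hzz').2.1 (hseg z hzβ (hband₂ z hz).1 (hband₂ z hz).2)
    · obtain ⟨z, z', hz, hzz', hzα⟩ := exists_adj_apply_eq hG' 0 α σ₃ ⟨zL₃, hzL₃, by omega⟩ ⟨zR₃, hzR₃, by omega⟩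
      exact (avoidGraph_adj.1 hzz').2.1 (hseg z hzα (hband₃ z hz).1 (hband₃ z hz).2)
    · obtain ⟨z, z', hz, hzz', hzβ⟩ := exists_adj_apply_eq hG' 1 β σ₄ ⟨zL₄, hzL₄, by omega⟩ ⟨zR₄, hzR₄, by omega⟩
      exact (avoidGraph_adj.1 hzz').2.1 (hseg z hzβ (hband₄ z hz).1 (hband₄ z hz).2)
  rw [hI, sub_zero] at hIII
  linarith

/-- **An admissible step of a chain of boxes**: the displacement from the next centre `c'` to the
previous centre `c` is exactly `24k` in one coordinate and at most `24k` in the other, so that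
the box of radius `12k` about `c` lies in the frame of `c'` and spans one of its four strips.
[folklore] -/
def ChainStep (c c' : Site 2) (k : ℕ) : Prop :=
  ((c 1 = c' 1 + 24 * k ∨ c 1 = c' 1 - 24 * k) ∧ |c 0 - c' 0| ≤ 24 * k) ∨
    ((c 0 = c' 0 + 24 * k ∨ c 0 = c' 0 - 24 * k) ∧ |c 1 - c' 1| ≤ 24 * k)

/-- **One step of the chain**: if `ChainStep c c' k`, the frame of `c'` is clean and inside `Λ`,
and `hitProb Λ B ≥ θ` on the box `mB c k`, then `hitProb Λ B ≥ maneuverConst · θ` on `mB c' k`.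
[cite: Chelkak2016, §3.2 (Harnack chain in the proof of Prop. 3.3)] -/
theorem hitProb_chain_step (hGr : Gr ≤ zdGraph 2) {Λ B : Set (Site 2)} (hΛ : Λ.Finite) {c c' : Site 2} {k : ℕ}
    (hk : 0 < k) (hstep : ChainStep c c' k) (hWΛ : mW c' k ⊆ Λ)
    (hclean : ∀ v ∈ mW c' k, ∀ e : SRW.Dir 2, Gr.Adj v (v + SRW.stepVec e))
    {θ : ℝ} (hθ0 : 0 < θ) (hθ1 : θ ≤ 1) (hθ : ∀ w ∈ mB c k, θ ≤ hitProb Gr Λ B w)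
    {x : Site 2} (hx : x ∈ mB c' k) : maneuverConst * θ ≤ hitProb Gr Λ B x := by
  -- first hit the previous box `mB c k`, then `B`
  have hBox : mB c k ⊆ mW c' k := by
    intro z hz
    simp only [mB, mW, Set.mem_setOf_eq] at hz ⊢
    obtain ⟨hz0, hz1⟩ := hz
    rw [abs_le] at hz0 hz1
    rcases hstep with ⟨h1 | h1, h0⟩ | ⟨h0 | h0, h1⟩
    · rw [abs_le] at h0; exact ⟨abs_le.2 ⟨by omega, by omega⟩, abs_le.2 ⟨by omega, by omega⟩⟩
    · rw [abs_le] at h0; exact ⟨abs_le.2 ⟨by omega, by omega⟩, abs_le.2 ⟨by omega, by omega⟩⟩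
    · rw [abs_le] at h1; exact ⟨abs_le.2 ⟨by omega, by omega⟩, abs_le.2 ⟨by omega, by omega⟩⟩
    · rw [abs_le] at h1; exact ⟨abs_le.2 ⟨by omega, by omega⟩, abs_le.2 ⟨by omega, by omega⟩⟩
  have h1 : maneuverConst ≤ hitProb Gr Λ (mB c k) x := by
    refine le_trans ?_ (one_sub_edgeSurvive_le_hitProb hΛ hBox hWΛ hclean x (mB_subset_mW hx))
    have h2 := edgeSurvive_avoidGraph_le_of_strip hGr (B := mB c k) (c := c') hk ?_ hx
    · linarith
    -- the box `mB c k` spans the appropriate strip of the frame of `c'`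
    rcases hstep with ⟨h1 | h1, h0⟩ | ⟨h0 | h0, h1⟩
    · -- `c` above `c'`: top strip, vertical segment at `α = c 0`
      rw [abs_le] at h0
      refine Or.inl ⟨c 0, by omega, by omega, fun z hz h2 h3 => ?_⟩
      simp only [mB, Set.mem_setOf_eq]; exact ⟨abs_le.2 ⟨by omega, by omega⟩, abs_le.2 ⟨by omega, by omega⟩⟩
    · -- `c` below `c'`: bottom strip
      rw [abs_le] at h0
      refine Or.inr (Or.inr (Or.inl ⟨c 0, by omega, by omega, fun z hz h2 h3 => ?_⟩))
      simp only [mB, Set.mem_setOf_eq]; exact ⟨abs_le.2 ⟨by omega, by omega⟩, abs_le.2 ⟨by omega, by omega⟩⟩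
    · -- `c` right of `c'`: right strip, horizontal segment at `β = c 1`
      rw [abs_le] at h1
      refine Or.inr (Or.inl ⟨c 1, by omega, by omega, fun z hz h2 h3 => ?_⟩)
      simp only [mB, Set.mem_setOf_eq]; exact ⟨abs_le.2 ⟨by omega, by omega⟩, abs_le.2 ⟨by omega, by omega⟩⟩
    · -- `c` left of `c'`: left strip
      rw [abs_le] at h1
      refine Or.inr (Or.inr (Or.inr ⟨c 1, by omega, by omega, fun z hz h2 h3 => ?_⟩))
      simp only [mB, Set.mem_setOf_eq]; exact ⟨abs_le.2 ⟨by omega, by omega⟩, abs_le.2 ⟨by omega, by omega⟩⟩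
  have h3 := mul_hitProb_le_of_le_on (Gr := Gr) (Λ := Λ) (B := B) (B' := mB c k) hΛ hθ0 hθ1 hθ x
  have h4 : θ * maneuverConst ≤ θ * hitProb Gr Λ (mB c k) x := mul_le_mul_of_nonneg_left h1 hθ0.le
  linarith [mul_comm θ maneuverConst]

/-- **A chain of boxes.** For centres `c 0, …, c n` with admissible steps, clean frames inside `Λ`
from the second one on, and a target `B ⊇ mB (c 0) k`:
`hitProb Λ B ≥ maneuverConst ^ i` on `mB (c i) k` for all `i ≤ n`. [cite: Chelkak2016, §3.2] -/
theorem hitProb_chain (hGr : Gr ≤ zdGraph 2) {Λ B : Set (Site 2)} (hΛ : Λ.Finite) {k : ℕ} (hk : 0 < k)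
    {n : ℕ} (c : ℕ → Site 2) (hB : mB (c 0) k ⊆ B)
    (hstep : ∀ i < n, ChainStep (c i) (c (i + 1)) k) (hWΛ : ∀ i, 0 < i → i ≤ n → mW (c i) k ⊆ Λ)
    (hclean : ∀ i, 0 < i → i ≤ n → ∀ v ∈ mW (c i) k, ∀ e : SRW.Dir 2, Gr.Adj v (v + SRW.stepVec e)) :
    ∀ i ≤ n, ∀ x ∈ mB (c i) k, maneuverConst ^ i ≤ hitProb Gr Λ B x := by
  intro i
  induction i with
  | zero =>
    intro _ x hx
    rw [pow_zero, hitProb_of_mem (hB hx)]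
  | succ i ih =>
    intro hi x hx
    have hθ := ih (by omega)
    have hmc1 : maneuverConst ^ i ≤ 1 := pow_le_one₀ maneuverConst_pos.le maneuverConst_le_one
    have := hitProb_chain_step hGr hΛ hk (hstep i (by omega)) (hWΛ (i + 1) (by omega) hi) (hclean (i + 1) (by omega) hi)
      (pow_pos maneuverConst_pos i) hmc1 hθ hx
    rw [pow_succ, mul_comm]
    exact this

end Literature.Probability.LatticeModels
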